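import Literature.Computability.Cryptography.LiuPassPadding
import HarnessLib

/-!
# The hybrid argument for repeated samples: coin-block bookkeeping (Goldreich 2001, Thm. 3.2.6)

Pure counting lemmas behind the proof of

> **Goldreich 2001, Theorem 3.2.6** (indistinguishability of repeated samples of efficiently
> constructible ensembles): the `m(n)`-fold products of two computationally indistinguishable,
> polynomial-time-constructible ensembles are computationally indistinguishable.

Printed proof (2004 printing, PDF pp. 139–141): hybrids
`H_n^k = (X^{(1)}, …, X^{(k)}, Y^{(k+1)}, …, Y^{(m)})`; the reduction `D'` selects `k`, samples `k`
copies of `X` and `m − k − 1` copies of `Y` itself and calls `D(x¹, …, xᵏ, α, y^{k+2}, …, yᵐ)`;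
**Claim 3.2.6.1**: `Pr[D'(X_n) = 1]` (with `k` fixed) `= Pr[D(H_n^{k+1}) = 1]` and
`Pr[D'(Y_n) = 1] = Pr[D(H_n^k) = 1]`; **Claim 3.2.6.2**: the gaps telescope, so some neighbouring
pair of hybrids is distinguished with gap `≥ Δ(n)/m`.

This file supplies these two claims in the tree's coin-counting formalism (`uniformAvg`,
`StatisticalDistance.lean`; `uniformAvg_add`, `LiuPassPadding.lean`), for samplers given as
deterministic maps of `a`-bit coin blocks (the shape of every efficiently constructible ensemble
once the security parameter is fixed: `X_n = S_X(U_a)`, `Y_n = S_Y(U_a)`):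

* `Hybrid.blk a j R` (block `j` of length `a` of the coin string `R`; twin of `Yao.blk`),
  `Hybrid.insAt a k s R'` (insert the block `s` in front of block `k`), with the block calculus
  `blk_insAt_of_lt / _self / _of_gt`;
* `Hybrid.hyb SX SY a m j R` — the sample of the hybrid `H^j` computed from `m` coin blocks
  (`SX` on blocks `< j`, `SY` on blocks `≥ j`), and `Hybrid.hybIns SX SY a m k α R'` — the query of
  the reduction (`α` in position `k`, its own `m − 1` blocks around it); the identities
  **`hyb (k+1) (insAt k s R') = hybIns k (SX s) R'`** and **`hyb k (insAt k s R') = hybIns k (SY s) R'`**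
  (`hyb_succ_insAt`, `hyb_insAt`);
* `uniformAvg_comm`, **`uniformAvg_insAt`** — inserting a uniform block into uniform blocks gives
  uniform blocks: `E_{R ← U_{ma}} F(R) = E_{s ← U_a} E_{R' ← U_{(m−1)a}} F(insAt k s R')`; hence
  **Claim 3.2.6.1** in the form `uniformAvg_hyb_succ` / `uniformAvg_hyb`
  (`E_s E_{R'} T(hybIns k (SX s) R') = E_R T(hyb (k+1) R)`, and with `SY`, `hyb k`), for any
  real-valued test `T` (the acceptance probability of `D` over its own coins);
* **Claim 3.2.6.2** as the pigeonhole `exists_hybrid_gap`: `|p m − p 0| ≤ m · |p (k+1) − p k|`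
  for some `k < m`;
* the **position-indexed** variants `Hybrid.hybI`, `Hybrid.hybInsI` (the sampler of block `i` may
  depend on `i`: `S_X i`, `S_Y i` — the shape of hybrid arguments over *different* constructible
  components, e.g. the enumeration/XOR-combiner step of Håstad–Impagliazzo–Levin–Luby) with the same
  identities `hybI_succ_insAt`, `hybI_insAt`, `uniformAvg_hybInsI_X/_Y`; the position-independent
  `hyb`/`hybIns` are their special case (`hyb_eq_hybI`, `hybIns_eq_hybInsI`).

Everything is proved; the reduction itself (a PPT machine) and Theorem 3.2.6 for the tree's
ensembles are assembled from these lemmas in a sequel.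

## References

* O. Goldreich, *Foundations of Cryptography I: Basic Tools*, CUP 2001 (2004 printing,
  doi:10.1017/CBO9780511721656): §3.2.3, Def. 3.2.4–3.2.5, Thm. 3.2.6 and its proof with
  Claims 3.2.6.1–3.2.6.2 (PDF pp. 139–141), "The Hybrid Technique: A Digest" (p. 141).
-/

namespace Literature.Computability.Cryptography

open Finset

/-! ### Iterated uniform averages commute -/

/-- **Fubini for uniform averages**: `E_{u ← U_a} E_{w ← U_b} φ(u, w) = E_w E_u φ(u, w)`. [folklore] -/
theorem uniformAvg_comm (a b : ℕ) (φ : List Bool → List Bool → ℝ) :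
    uniformAvg a (fun u => uniformAvg b fun w => φ u w) =
      uniformAvg b (fun w => uniformAvg a fun u => φ u w) := by
  unfold uniformAvg
  simp only [Finset.sum_div]
  rw [Finset.sum_comm]
  refine Finset.sum_congr rfl fun w _ => Finset.sum_congr rfl fun u _ => ?_
  rw [div_div, div_div, mul_comm]

/-- A uniform average of a function of the whole string, split as prefix and suffix:
`E_{x ← U_{a+b}} F(x) = E_{u ← U_a} E_{w ← U_b} F(u ++ w)`. [folklore] -/
theorem uniformAvg_append (a b : ℕ) (F : List Bool → ℝ) :
    uniformAvg (a + b) F = uniformAvg a fun u => uniformAvg b fun w => F (u ++ w) := by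
  rw [← uniformAvg_add a b fun u w => F (u ++ w)]
  exact uniformAvg_congr fun x _ => by rw [List.take_append_drop]

namespace Hybrid

/-! ### Coin blocks -/

/-- Block `j` (of length `a`) of the coin string `R`: `(R ⇂ ja) ↾ a` (twin of `Yao.blk` of
`YaoAmplification.lean`, same argument order; a local copy keeps the import closure small).
[Goldreich 2001, Def. 3.2.4 (independent copies read off disjoint coins)] [folklore] -/
def blk (a j : ℕ) (R : List Bool) : List Bool := (R.drop (j * a)).take a

/-- Insert the block `s` in front of block `k` of `R'`: `R' ↾ ka ++ s ++ R' ⇂ ka`.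
[Goldreich 2001, Thm. 3.2.6 (proof: `α` placed in position `k + 1`)] [folklore] -/
def insAt (a k : ℕ) (s R' : List Bool) : List Bool := R'.take (k * a) ++ s ++ R'.drop (k * a)

/-- Length of an insertion. [folklore] -/
@[simp] theorem length_insAt (a k : ℕ) (s R' : List Bool) :
    (insAt a k s R').length = R'.length + s.length := by
  simp only [insAt, List.length_append, List.length_take, List.length_drop]
  omega

/-- On a concatenation `P ++ Q` with `|P| = ka`, inserting in front of block `k` is `P ++ s ++ Q`.
[folklore] -/
theorem insAt_append {a k : ℕ} {P : List Bool} (hP : P.length = k * a) (s Q : List Bool) :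
    insAt a k s (P ++ Q) = P ++ s ++ Q := by
  simp only [insAt]
  rw [List.take_append_of_le_length hP.ge, List.drop_append_of_le_length hP.ge,
    List.take_of_length_le hP.le, List.drop_of_length_le hP.le, List.nil_append]

/-- Blocks before the insertion point are unchanged. [folklore] -/
theorem blk_insAt_of_lt {a k i : ℕ} (hi : i < k) {s R' : List Bool} (hR : k * a ≤ R'.length) :
    blk a i (insAt a k s R') = blk a i R' := by
  have hP : (R'.take (k * a)).length = k * a := by simp; omega
  have hia : i * a + a ≤ k * a := by
    have : (i + 1) * a ≤ k * a := Nat.mul_le_mul_right a hi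
    rwa [Nat.add_mul, one_mul] at this
  simp only [blk, insAt, List.append_assoc]
  rw [List.drop_append_of_le_length (by omega), List.take_append_of_le_length (by simp; omega),
    List.drop_take, List.take_take]
  congr 1
  omega

/-- The inserted block reads back. [folklore] -/
theorem blk_insAt_self {a k : ℕ} {s R' : List Bool} (hs : s.length = a) (hR : k * a ≤ R'.length) :
    blk a k (insAt a k s R') = s := by
  have hP : (R'.take (k * a)).length = k * a := by simp; omega
  simp only [blk, insAt, List.append_assoc]
  rw [List.drop_append_of_le_length hP.ge, List.drop_of_length_le hP.le, List.nil_append,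
    List.take_append_of_le_length hs.ge, List.take_of_length_le hs.le]

/-- Blocks after the insertion point are the previous blocks of `R'`. [folklore] -/
theorem blk_insAt_of_gt {a k i : ℕ} (hi : k < i) {s R' : List Bool} (hs : s.length = a)
    (hR : k * a ≤ R'.length) : blk a i (insAt a k s R') = blk a (i - 1) R' := by
  have hP : (R'.take (k * a)).length = k * a := by simp; omega
  have hPs : (R'.take (k * a) ++ s).length = k * a + a := by simp [hs]; omega
  have hka : k * a + a ≤ i * a := by
    have : (k + 1) * a ≤ i * a := Nat.mul_le_mul_right a hi
    rwa [Nat.add_mul, one_mul] at this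
  simp only [blk, insAt]
  rw [List.drop_append, hPs, List.drop_of_length_le (by rw [hPs]; exact hka), List.nil_append,
    List.drop_drop]
  conv_rhs => rw [← List.take_append_drop (k * a) R', List.drop_append, hP,
    List.drop_of_length_le (l := R'.take (k * a)) (by
      rw [hP]; have : k * a ≤ (i - 1) * a := Nat.mul_le_mul_right a (by omega); exact this),
    List.nil_append, List.drop_drop]
  congr 2
  have h1 : (i - 1) * a = i * a - a := by rw [Nat.sub_mul, one_mul]
  rw [h1]
  have : a ≤ i * a := by
    calc a = 1 * a := (one_mul a).symm
      _ ≤ i * a := Nat.mul_le_mul_right a (by omega)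
  omega

/-! ### Hybrid samples -/

/-- **The sample of the hybrid `H^j`** computed from `m` coin blocks of `R`: `S_X` on the blocks
`i < j`, `S_Y` on the blocks `i ≥ j`, concatenated (`H^m`: all `X`; `H^0`: all `Y`).
[Goldreich 2001, Thm. 3.2.6 (proof: the hybrids `H_n^k`)] [cite: Goldreich2001, Thm. 3.2.6 (proof, hybrids)] -/
def hyb (SX SY : List Bool → List Bool) (a m j : ℕ) (R : List Bool) : List Bool :=
  ((List.range m).map fun i => (if i < j then SX else SY) (blk a i R)).flatten

/-- **The query of the reduction**: `k` samples of `X` from the first `k` blocks of its own coins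
`R'`, then the input sample `α`, then `m − 1 − k` samples of `Y` from the next blocks
(`D'(α) = D(x¹, …, xᵏ, α, y^{k+2}, …, yᵐ)`). [Goldreich 2001, Thm. 3.2.6 (proof: algorithm `D'`)]
[cite: Goldreich2001, Thm. 3.2.6 (proof, algorithm D')] -/
def hybIns (SX SY : List Bool → List Bool) (a m k : ℕ) (α R' : List Bool) : List Bool :=
  ((List.range k).map fun i => SX (blk a i R')).flatten ++ α ++
    ((List.range (m - 1 - k)).map fun i => SY (blk a (k + i) R')).flatten

/-- Splitting the index range of the hybrids at position `k < m`:
`[0, m) = [0, k) ++ [k] ++ (k + 1 + [0, m − 1 − k))`. [folklore] -/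
theorem range_split {m k : ℕ} (hk : k < m) :
    List.range m = List.range k ++ [k] ++ (List.range (m - 1 - k)).map (k + 1 + ·) := by
  conv_lhs => rw [show m = (k + 1) + (m - 1 - k) by omega]
  rw [List.range_add, List.range_succ]

/-- **`H^{k+1}` with an `X`-sample inserted**: if block `k` of `R` is a fresh block `s`, the sample
of `H^{k+1}` from `R = insAt k s R'` is the reduction's query on `α = S_X(s)`.
[Goldreich 2001, Claim 3.2.6.1 (proof)] [cite: Goldreich2001, Claim 3.2.6.1] -/
theorem hyb_succ_insAt (SX SY : List Bool → List Bool) {a m k : ℕ} (hk : k < m) {s R' : List Bool}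
    (hs : s.length = a) (hR : k * a ≤ R'.length) :
    hyb SX SY a m (k + 1) (insAt a k s R') = hybIns SX SY a m k (SX s) R' := by
  rw [hyb, range_split hk, hybIns]
  simp only [List.map_append, List.map_cons, List.map_nil, List.flatten_append, List.flatten_cons,
    List.flatten_nil, List.append_nil, List.map_map]
  congr 1
  · congr 1
    · refine congrArg List.flatten (List.map_congr_left fun i hi => ?_)
      rw [List.mem_range] at hi
      rw [if_pos (by omega), blk_insAt_of_lt hi hR]
    · rw [if_pos (Nat.lt_succ_self k), blk_insAt_self hs hR]
  · refine congrArg List.flatten (List.map_congr_left fun i hi => ?_)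
    simp only [Function.comp_apply]
    rw [if_neg (by omega), blk_insAt_of_gt (by omega) hs hR]
    congr 2
    omega

/-- **`H^k` with a `Y`-sample inserted**: if block `k` of `R` is a fresh block `s`, the sample of
`H^k` from `R = insAt k s R'` is the reduction's query on `α = S_Y(s)`.
[Goldreich 2001, Claim 3.2.6.1 (proof)] [cite: Goldreich2001, Claim 3.2.6.1] -/
theorem hyb_insAt (SX SY : List Bool → List Bool) {a m k : ℕ} (hk : k < m) {s R' : List Bool}
    (hs : s.length = a) (hR : k * a ≤ R'.length) :
    hyb SX SY a m k (insAt a k s R') = hybIns SX SY a m k (SY s) R' := by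
  rw [hyb, range_split hk, hybIns]
  simp only [List.map_append, List.map_cons, List.map_nil, List.flatten_append, List.flatten_cons,
    List.flatten_nil, List.append_nil, List.map_map]
  congr 1
  · congr 1
    · refine congrArg List.flatten (List.map_congr_left fun i hi => ?_)
      rw [List.mem_range] at hi
      rw [if_pos hi, blk_insAt_of_lt hi hR]
    · rw [if_neg (lt_irrefl k), blk_insAt_self hs hR]
  · refine congrArg List.flatten (List.map_congr_left fun i hi => ?_)
    simp only [Function.comp_apply]
    rw [if_neg (by omega), blk_insAt_of_gt (by omega) hs hR]
    congr 2
    omega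

/-! ### Inserting a uniform block into uniform blocks -/

/-- **Inserting a uniform block among uniform blocks gives uniform blocks**: for `k < m`,
`E_{R ← U_{ma}} F(R) = E_{s ← U_a} E_{R' ← U_{(m−1)a}} F(insAt k s R')` (the coin string of
`H^k`/`H^{k+1}` read as the reduction's coins with the input sample's coins spliced in).
[Goldreich 2001, Claim 3.2.6.1 (proof: "by construction of algorithm `D'`")] [cite: Goldreich2001, Claim 3.2.6.1] -/
theorem uniformAvg_insAt {a m k : ℕ} (hk : k < m) (F : List Bool → ℝ) :
    uniformAvg (m * a) F = uniformAvg a fun s => uniformAvg ((m - 1) * a) fun R' => F (insAt a k s R') := by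
  have hsplit : m = k + 1 + (m - 1 - k) := by omega
  have hm : m * a = k * a + (a + (m - 1 - k) * a) := by
    conv_lhs => rw [hsplit]
    ring
  have hm' : (m - 1) * a = k * a + (m - 1 - k) * a := by
    rw [← Nat.add_mul]
    exact congrArg (· * a) (by omega)
  rw [hm, uniformAvg_append, hm']
  calc uniformAvg (k * a) (fun P => uniformAvg (a + (m - 1 - k) * a) fun W => F (P ++ W))
      = uniformAvg (k * a) (fun P => uniformAvg a fun s =>
          uniformAvg ((m - 1 - k) * a) fun Q => F (P ++ (s ++ Q))) :=
        congrArg _ (funext fun P => uniformAvg_append a _ _)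
    _ = uniformAvg a (fun s => uniformAvg (k * a) fun P =>
          uniformAvg ((m - 1 - k) * a) fun Q => F (P ++ (s ++ Q))) := uniformAvg_comm _ _ _
    _ = uniformAvg a (fun s => uniformAvg (k * a + (m - 1 - k) * a) fun R' => F (insAt a k s R')) := by
        refine congrArg _ (funext fun s => ?_)
        rw [uniformAvg_append]
        refine uniformAvg_congr fun P hP => congrArg _ (funext fun Q => ?_)
        rw [insAt_append hP, List.append_assoc]

/-! ### Claim 3.2.6.1: the reduction's acceptance probabilities are hybrid acceptance probabilities -/

/-- **Claim 3.2.6.1, `X` side**: for any real-valued test `T` (e.g. the acceptance probability of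
`D` over its own coins), `E_{s ← U_a} E_{R' ← U_{(m−1)a}} T(hybIns k (S_X s) R') = E_{R ← U_{ma}} T(hyb (k+1) R)`
— "`Pr[D'(X_n) = 1] = Pr[D(H_n^{k+1}) = 1]`" for the reduction with index `k < m`.
[cite: Goldreich2001, Claim 3.2.6.1 (PDF p. 140)] -/
theorem uniformAvg_hybIns_X (SX SY : List Bool → List Bool) {a m k : ℕ} (hk : k < m)
    (T : List Bool → ℝ) :
    uniformAvg a (fun s => uniformAvg ((m - 1) * a) fun R' => T (hybIns SX SY a m k (SX s) R')) =
      uniformAvg (m * a) fun R => T (hyb SX SY a m (k + 1) R) := by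
  rw [uniformAvg_insAt hk]
  refine uniformAvg_congr fun s hs => uniformAvg_congr fun R' hR' => ?_
  rw [hyb_succ_insAt SX SY hk hs (by rw [hR']; exact Nat.mul_le_mul_right a (by omega))]

/-- **Claim 3.2.6.1, `Y` side**: `E_{s ← U_a} E_{R' ← U_{(m−1)a}} T(hybIns k (S_Y s) R') =
E_{R ← U_{ma}} T(hyb k R)` — "`Pr[D'(Y_n) = 1] = Pr[D(H_n^k) = 1]`".
[cite: Goldreich2001, Claim 3.2.6.1 (PDF p. 140)] -/
theorem uniformAvg_hybIns_Y (SX SY : List Bool → List Bool) {a m k : ℕ} (hk : k < m)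
    (T : List Bool → ℝ) :
    uniformAvg a (fun s => uniformAvg ((m - 1) * a) fun R' => T (hybIns SX SY a m k (SY s) R')) =
      uniformAvg (m * a) fun R => T (hyb SX SY a m k R) := by
  rw [uniformAvg_insAt hk]
  refine uniformAvg_congr fun s hs => uniformAvg_congr fun R' hR' => ?_
  rw [hyb_insAt SX SY hk hs (by rw [hR']; exact Nat.mul_le_mul_right a (by omega))]

/-- The extreme hybrids: `H^m` is the all-`X` product sample and `H^0` the all-`Y` product sample.
[Goldreich 2001, Thm. 3.2.6 (proof: "Clearly, `H_n^m = (X…)`, whereas `H_n^0 = (Y…)`")]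
[cite: Goldreich2001, Thm. 3.2.6 (proof)] -/
theorem hyb_self (SX SY : List Bool → List Bool) (a m : ℕ) (R : List Bool) :
    hyb SX SY a m m R = ((List.range m).map fun i => SX (blk a i R)).flatten := by
  unfold hyb
  refine congrArg List.flatten (List.map_congr_left fun i hi => ?_)
  rw [List.mem_range] at hi
  rw [if_pos hi]

/-- The extreme hybrid `H^0` (all `Y`). [cite: Goldreich2001, Thm. 3.2.6 (proof)] -/
theorem hyb_zero (SX SY : List Bool → List Bool) (a m : ℕ) (R : List Bool) :
    hyb SX SY a m 0 R = ((List.range m).map fun i => SY (blk a i R)).flatten := by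
  unfold hyb
  refine congrArg List.flatten (List.map_congr_left fun i _ => ?_)
  rw [if_neg (Nat.not_lt_zero i)]

/-! ### Claim 3.2.6.2: some neighbouring hybrids are distinguished -/

/-- **Claim 3.2.6.2 (pigeonhole over the hybrids)**: for `m ≥ 1` hybrid steps with acceptance
probabilities `p 0, …, p m`, some neighbouring pair satisfies `|p m − p 0| ≤ m · |p (k+1) − p k|`
(the gaps telescope: `Σ_{k<m} (p(k+1) − p k) = p m − p 0`). [cite: Goldreich2001, Claim 3.2.6.2 (PDF p. 141)] -/
theorem exists_hybrid_gap (p : ℕ → ℝ) {m : ℕ} (hm : 0 < m) :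
    ∃ k < m, |p m - p 0| ≤ m * |p (k + 1) - p k| := by
  by_contra h
  push Not at h
  have htel : p m - p 0 = ∑ k ∈ Finset.range m, (p (k + 1) - p k) := (Finset.sum_range_sub p m).symm
  have h1 : |p m - p 0| ≤ ∑ k ∈ Finset.range m, |p (k + 1) - p k| := by
    rw [htel]; exact Finset.abs_sum_le_sum_abs _ _
  have h2 : ∑ k ∈ Finset.range m, (m : ℝ) * |p (k + 1) - p k| < ∑ _k ∈ Finset.range m, |p m - p 0| :=
    Finset.sum_lt_sum_of_nonempty ⟨0, by simp [hm]⟩ fun k hk => h k (Finset.mem_range.1 hk)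
  rw [Finset.sum_const, Finset.card_range, nsmul_eq_mul, ← Finset.mul_sum] at h2
  have hm' : (0 : ℝ) < m := by exact_mod_cast hm
  have h3 : ∑ k ∈ Finset.range m, |p (k + 1) - p k| < |p m - p 0| := lt_of_mul_lt_mul_left h2 hm'.le
  linarith

/-- **Claim 3.2.6.2, advantage form**: if the extreme hybrids are told apart with gap `Δ`, some
neighbouring pair is told apart with gap `≥ Δ / m`. [cite: Goldreich2001, Claim 3.2.6.2 (PDF p. 141)] -/
theorem exists_hybrid_gap_div (p : ℕ → ℝ) {m : ℕ} (hm : 0 < m) :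
    ∃ k < m, |p m - p 0| / m ≤ |p (k + 1) - p k| := by
  obtain ⟨k, hk, h⟩ := exists_hybrid_gap p hm
  have hm' : (0 : ℝ) < m := by exact_mod_cast hm
  exact ⟨k, hk, by rw [div_le_iff₀ hm', mul_comm]; exact h⟩

/-! ### Position-indexed samplers

The same bookkeeping when the sampler of block `i` depends on the position `i` (`S_X i`, `S_Y i`):
hybrid arguments over tuples of *different* constructible components. -/

/-- **The sample of the indexed hybrid `H^j`**: `S_X i` on the blocks `i < j`, `S_Y i` on the blocks
`i ≥ j`. [Goldreich 2001, Thm. 3.2.6 (proof: the hybrids `H_n^k`), §3.2.3 digest] [cite: Goldreich2001, Thm. 3.2.6 (proof, hybrids)] -/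
def hybI (SX SY : ℕ → List Bool → List Bool) (a m j : ℕ) (R : List Bool) : List Bool :=
  ((List.range m).map fun i => (if i < j then SX i else SY i) (blk a i R)).flatten

/-- **The query of the indexed reduction**: `S_X i` on its blocks `i < k`, the input sample `α` at
position `k`, `S_Y i` (position `i = k + 1 + i'`) on its blocks `k + i'`.
[cite: Goldreich2001, Thm. 3.2.6 (proof, algorithm D')] -/
def hybInsI (SX SY : ℕ → List Bool → List Bool) (a m k : ℕ) (α R' : List Bool) : List Bool :=
  ((List.range k).map fun i => SX i (blk a i R')).flatten ++ α ++
    ((List.range (m - 1 - k)).map fun i => SY (k + 1 + i) (blk a (k + i) R')).flatten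

/-- The position-independent hybrid is the indexed one with constant samplers. [folklore] -/
theorem hyb_eq_hybI (SX SY : List Bool → List Bool) (a m j : ℕ) (R : List Bool) :
    hyb SX SY a m j R = hybI (fun _ => SX) (fun _ => SY) a m j R := by
  unfold hyb hybI
  refine congrArg List.flatten (List.map_congr_left fun i _ => ?_)
  split_ifs <;> rfl

/-- The position-independent query is the indexed one with constant samplers. [folklore] -/
theorem hybIns_eq_hybInsI (SX SY : List Bool → List Bool) (a m k : ℕ) (α R' : List Bool) :
    hybIns SX SY a m k α R' = hybInsI (fun _ => SX) (fun _ => SY) a m k α R' := rfl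

/-- **Indexed `H^{k+1}` with an `X`-sample inserted.** [cite: Goldreich2001, Claim 3.2.6.1] -/
theorem hybI_succ_insAt (SX SY : ℕ → List Bool → List Bool) {a m k : ℕ} (hk : k < m) {s R' : List Bool}
    (hs : s.length = a) (hR : k * a ≤ R'.length) :
    hybI SX SY a m (k + 1) (insAt a k s R') = hybInsI SX SY a m k (SX k s) R' := by
  rw [hybI, range_split hk, hybInsI]
  simp only [List.map_append, List.map_cons, List.map_nil, List.flatten_append, List.flatten_cons,
    List.flatten_nil, List.append_nil, List.map_map]
  congr 1
  · congr 1
    · refine congrArg List.flatten (List.map_congr_left fun i hi => ?_)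
      rw [List.mem_range] at hi
      rw [if_pos (by omega), blk_insAt_of_lt hi hR]
    · rw [if_pos (Nat.lt_succ_self k), blk_insAt_self hs hR]
  · refine congrArg List.flatten (List.map_congr_left fun i hi => ?_)
    simp only [Function.comp_apply]
    rw [if_neg (by omega), blk_insAt_of_gt (by omega) hs hR]
    congr 2
    omega

/-- **Indexed `H^k` with a `Y`-sample inserted.** [cite: Goldreich2001, Claim 3.2.6.1] -/
theorem hybI_insAt (SX SY : ℕ → List Bool → List Bool) {a m k : ℕ} (hk : k < m) {s R' : List Bool}
    (hs : s.length = a) (hR : k * a ≤ R'.length) :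
    hybI SX SY a m k (insAt a k s R') = hybInsI SX SY a m k (SY k s) R' := by
  rw [hybI, range_split hk, hybInsI]
  simp only [List.map_append, List.map_cons, List.map_nil, List.flatten_append, List.flatten_cons,
    List.flatten_nil, List.append_nil, List.map_map]
  congr 1
  · congr 1
    · refine congrArg List.flatten (List.map_congr_left fun i hi => ?_)
      rw [List.mem_range] at hi
      rw [if_pos hi, blk_insAt_of_lt hi hR]
    · rw [if_neg (lt_irrefl k), blk_insAt_self hs hR]
  · refine congrArg List.flatten (List.map_congr_left fun i hi => ?_)
    simp only [Function.comp_apply]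
    rw [if_neg (by omega), blk_insAt_of_gt (by omega) hs hR]
    congr 2
    omega

/-- **Claim 3.2.6.1, `X` side, indexed samplers.** [cite: Goldreich2001, Claim 3.2.6.1 (PDF p. 140)] -/
theorem uniformAvg_hybInsI_X (SX SY : ℕ → List Bool → List Bool) {a m k : ℕ} (hk : k < m)
    (T : List Bool → ℝ) :
    uniformAvg a (fun s => uniformAvg ((m - 1) * a) fun R' => T (hybInsI SX SY a m k (SX k s) R')) =
      uniformAvg (m * a) fun R => T (hybI SX SY a m (k + 1) R) := by
  rw [uniformAvg_insAt hk]
  refine uniformAvg_congr fun s hs => uniformAvg_congr fun R' hR' => ?_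
  rw [hybI_succ_insAt SX SY hk hs (by rw [hR']; exact Nat.mul_le_mul_right a (by omega))]

/-- **Claim 3.2.6.1, `Y` side, indexed samplers.** [cite: Goldreich2001, Claim 3.2.6.1 (PDF p. 140)] -/
theorem uniformAvg_hybInsI_Y (SX SY : ℕ → List Bool → List Bool) {a m k : ℕ} (hk : k < m)
    (T : List Bool → ℝ) :
    uniformAvg a (fun s => uniformAvg ((m - 1) * a) fun R' => T (hybInsI SX SY a m k (SY k s) R')) =
      uniformAvg (m * a) fun R => T (hybI SX SY a m k R) := by
  rw [uniformAvg_insAt hk]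
  refine uniformAvg_congr fun s hs => uniformAvg_congr fun R' hR' => ?_
  rw [hybI_insAt SX SY hk hs (by rw [hR']; exact Nat.mul_le_mul_right a (by omega))]

/-- The extreme indexed hybrid `H^m` (all `X`). [cite: Goldreich2001, Thm. 3.2.6 (proof)] -/
theorem hybI_self (SX SY : ℕ → List Bool → List Bool) (a m : ℕ) (R : List Bool) :
    hybI SX SY a m m R = ((List.range m).map fun i => SX i (blk a i R)).flatten := by
  unfold hybI
  refine congrArg List.flatten (List.map_congr_left fun i hi => ?_)
  rw [List.mem_range] at hi
  rw [if_pos hi]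

/-- The extreme indexed hybrid `H^0` (all `Y`). [cite: Goldreich2001, Thm. 3.2.6 (proof)] -/
theorem hybI_zero (SX SY : ℕ → List Bool → List Bool) (a m : ℕ) (R : List Bool) :
    hybI SX SY a m 0 R = ((List.range m).map fun i => SY i (blk a i R)).flatten := by
  unfold hybI
  refine congrArg List.flatten (List.map_congr_left fun i _ => ?_)
  rw [if_neg (Nat.not_lt_zero i)]

end Hybrid

end Literature.Computability.Cryptography
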